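import Literature.NumberTheory.GaloisRepresentations.KummerTresRamifieProofs
import Literature.NumberTheory.GaloisCohomology.KummerClassLocalSurjective
import Literature.NumberTheory.GaloisCohomology.LocalInvariantOfUnramifiedClass
import HarnessLib

/-!
# A *peu ramifié* Kummer class is the class of a UNIT, and its cup product with an unramified
# character vanishes (Serre, Duke 54 (1987) §2.4 (ii); Serre, *Local Fields* IV §§2–3, X §3, XIII §4)

`Proofs` file (theorems only: no definition, no named fact, no instance, no notation, no `sorry`) in topic
`NumberTheory/GaloisCohomology`; the COHOMOLOGICAL packaging of the Kummer ramification jump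
`GaloisRepresentations/KummerTresRamifieProofs` («`p ∤ v_F(x)` ⇒ très ramifié», x9-p2 g5) in the tree's
Kummer currency (`isSES_kummer … .δ₀`, `baseUnitsInvariant`, `contOneCocycles (mu F p).toTopRep`,
`KummerClassLocalSurjective`) and of the class-field-theoretic vanishing
`cupProduct_kummer_scalarCocycle_eq_zero_of_unit` (`LocalInvariantOfUnramifiedClass`).  Written by the
cell `pub/bsd-print-x9`, seat `bsd-line-x9-p2` (g5), road (R-g) of the shared μ-crux's STUB A input
(H5B-P-ANOM)/(A1u): the leaf (β) «`c̄_E ∪ ā = 0` in `H²(Γ_{K_w}, μ_p)` for `c̄_E` the (peu ramifié) extension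
class of `E[p]|Γ_{K_w}` at an anomalous `w ∣ p` and `ā` unramified», modulo only the consumer's transport
of `c̄_E` into `H¹(Γ_{K_w}, μ_p)` (at an anomalous place `Fil_w E[p] ≅ μ_p`).

For `F` a characteristic-`0` non-archimedean local field in which `p` is a UNIFORMISER:

* `smul_eq_self_of_mem_absUpperInertia_of_pow_eq_one` — **`I_F^u`, `u > 0`, fixes `μ_p(F̄)`** (the image
  of `I_F^u` in `Aut(μ_p) ≅ (ℤ/p)^×` is a `p`-group, `absUpperInertia_map_isPGroup`, in a group of order
  `p - 1`): the vanishing of a `μ_p`-valued cocycle on `I_F^u` depends only on its class.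
* **`exists_oneCocycleClass_eq_δ₀_unit_of_forall_absUpperInertia`** — if a continuous `1`-cocycle
  `φ : Γ_F → μ_p` VANISHES on every `I_F^u`, `u > 1` (peu ramifié), then `[φ] = κ_p(w) = δ₀(w)` for a UNIT
  `w` (`valuation F w = 1`): `[φ] = κ_p(x)` (`exists_δ₀_baseUnitsInvariant_eq`); a `p`-th root `w₀` of `x`
  with the coboundary witness `m` of `[φ] = [δ₀Cocycle w₀]` gives the root `w₀·m` whose Kummer cocycle is
  `φ` ON THE NOSE (`f_δ₀Cocycle_apply`), so `I_F^u` fixes that root; clearing denominators and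
  `exists_eq_unit_mul_pow_of_forall_absUpperInertia_smul_eq` give `x = w·(z/d)^p`, and
  `δ₀_baseUnitsInvariant_mul_pow` drops the `p`-th power.
* **`cupProduct_oneCocycleClass_scalarCocycle_eq_zero_of_forall_absUpperInertia`** — hence
  `[φ] ∪ [θ·id] = 0` in `H²(Γ_F, μ_p)` for every UNRAMIFIED `θ : Γ_F → ℤ/p`
  (`cupProduct_kummer_scalarCocycle_eq_zero_of_unit`: units are norms from the unramified extension).

HONEST FRAMING: classical Kummer theory + local class field theory already in the tree, assembled; `p`
uniformiser (`e(F/ℚ_p) = 1`) as in the jump file.  Proves no case of BSD; no summit statement is proved.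

## References

* J.-P. Serre, *Sur les représentations modulaires de degré 2 de Gal(ℚ̄/ℚ)*, Duke Math. J. 54 (1987),
  §2.4 (ii), §2.8 Prop. 3. [Serre1987]
* J.-P. Serre, *Local Fields*, GTM 67 (1979), Ch. IV §2 Cor. 3 of Prop. 7, §3 Remark 1, §4; Ch. X §3
  (Kummer theory, Hilbert 90); Ch. XIII §4 Prop. 13 (`(χ, u) = 0` for units and unramified `χ`). [SerreLocalFields1979]
* J.-P. Serre, *Galois Cohomology* (1997), II §1.2. [SerreGaloisCohomology1997]
-/

noncomputable section

open CategoryTheory Function Field ValuativeRel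
open scoped Valued

universe u

namespace Literature.NumberTheory.GaloisCohomology

open _root_.ContinuousCohomology
open Literature.NumberTheory.GaloisRepresentations
open Literature.NumberTheory.GaloisRepresentations.DiscreteGaloisModule
open Literature.NumberTheory.GaloisRepresentations.IsNonarchimedeanLocalField
open Literature.AnabelianGeometry.AbsoluteAnabelian
open Literature.AnabelianGeometry.AbsoluteAnabelian.Prop121vii

variable (F : Type u) [Field F] [ValuativeRel F] [TopologicalSpace F] [IsNonarchimedeanLocalField F]
  [CharZero F]

omit [CharZero F] in
/-- The residue characteristic of `F` is `p` when `p` is a uniformiser. [folklore] -/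
private theorem ringChar_residueField_eq_of_irreducible' {p : ℕ} [hp : Fact p.Prime]
    (hirr : Irreducible ((p : ℕ) : 𝒪[F])) : ringChar 𝓀[F] = p := by
  have hmem : ((p : ℕ) : 𝒪[F]) ∈ 𝓂[F] := (IsLocalRing.mem_maximalIdeal _).mpr hirr.not_isUnit
  have h0 : ((p : ℕ) : 𝓀[F]) = 0 := by
    rw [← map_natCast (IsLocalRing.residue 𝒪[F]), IsLocalRing.residue_eq_zero_iff]
    exact hmem
  exact (Nat.prime_dvd_prime_iff_eq (ringChar_residueField_prime (F := F)) hp.out).mp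
    ((ringChar.spec _ p).mp h0)

set_option maxHeartbeats 400000 in
/-- **The upper ramification groups `I_F^u`, `u > 0`, fix the `p`-th roots of unity** (`p` the residue
characteristic, here a uniformiser): the image of `I_F^u` in `Aut(μ_p) = (ℤ/p)^×` is a `p`-group
(`absUpperInertia_map_isPGroup`: `I_F^u ≤ G_1`, Serre IV §2 Cor. 3) inside a group of order `p - 1`,
hence trivial — `F(ζ_p)/F` is tamely ramified.  (So the hypothesis «`φ` vanishes on `I_F^u`» below does
not depend on the cocycle representing a class.)
[cite: SerreLocalFields1979, Ch. IV §2 Cor. 3 of Prop. 7, §3 Remark 1, §4 Prop. 16] -/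
theorem smul_eq_self_of_mem_absUpperInertia_of_pow_eq_one
    {p : ℕ} [hp : Fact p.Prime] (hirr : Irreducible ((p : ℕ) : 𝒪[F])) {u : ℝ} (hu : 0 < u)
    {σ : absoluteGaloisGroup F} (hσ : σ ∈ absUpperInertia F u)
    {ζ : AlgebraicClosure F} (hζ : ζ ^ p = 1) : σ • ζ = ζ := by
  classical
  have hp1 : p.Prime := hp.out
  haveI : NeZero p := ⟨hp1.ne_zero⟩
  haveI : Fact (1 < p) := ⟨hp1.one_lt⟩
  -- a primitive `p`-th root of unity `ζ₀`; `ζ = ζ₀^j`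
  obtain ⟨ζ₀, hζ₀⟩ : ∃ ζ₀ : AlgebraicClosure F, IsPrimitiveRoot ζ₀ p := by
    obtain ⟨ζ₀, hζ₀⟩ := IsAlgClosed.exists_root (Polynomial.cyclotomic p (AlgebraicClosure F)) (by
      rw [Polynomial.degree_cyclotomic, Nat.totient_prime hp1]
      exact_mod_cast (Nat.sub_pos_of_lt hp1.one_lt).ne')
    exact ⟨ζ₀, Polynomial.isRoot_cyclotomic_iff.mp hζ₀⟩
  obtain ⟨j, -, rfl⟩ := hζ₀.eq_pow_of_pow_eq_one hζ
  suffices h : σ • ζ₀ = ζ₀ by rw [smul_pow', h]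
  -- the action on `ζ₀` as a continuous character `Γ_F → (ℤ/p)^×`
  set χ : absoluteGaloisGroup F →* (ZMod p)ˣ :=
    (hζ₀.autToPow F).comp (absoluteGaloisGroup.toAlgEquiv F).toMonoidHom with hχdef
  have hχspec : ∀ τ : absoluteGaloisGroup F, ζ₀ ^ ((χ τ : ZMod p)).val = τ • ζ₀ := fun τ ↦
    hζ₀.autToPow_spec F (absoluteGaloisGroup.toAlgEquiv F τ)
  have hχeq : ∀ τ τ' : absoluteGaloisGroup F, τ • ζ₀ = τ' • ζ₀ → χ τ = χ τ' := by
    intro τ τ' h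
    have h1 : ζ₀ ^ ((χ τ : ZMod p)).val = ζ₀ ^ ((χ τ' : ZMod p)).val := by rw [hχspec, hχspec, h]
    exact Units.ext (ZMod.val_injective p
      (hζ₀.pow_inj (ZMod.val_lt _) (ZMod.val_lt _) h1))
  have hζ₀0 : ζ₀ ≠ 0 := hζ₀.ne_zero hp1.ne_zero
  set α₀ : (AlgebraicClosure F)ˣ := Units.mk0 ζ₀ hζ₀0 with hα₀def
  have hlc : IsLocallyConstant (χ : absoluteGaloisGroup F → (ZMod p)ˣ) := by
    let g : (AlgebraicClosure F)ˣ → (ZMod p)ˣ := fun β ↦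
      if h : ∃ τ : absoluteGaloisGroup F, τ • α₀ = β then χ h.choose else 1
    have hfg : (χ : absoluteGaloisGroup F → (ZMod p)ˣ) = g ∘ fun τ ↦ τ • α₀ := by
      funext τ
      have hex : ∃ τ' : absoluteGaloisGroup F, τ' • α₀ = τ • α₀ := ⟨τ, rfl⟩
      simp only [Function.comp_apply, g, dif_pos hex]
      refine hχeq _ _ ?_
      have h := congrArg (fun β : (AlgebraicClosure F)ˣ ↦ (β : AlgebraicClosure F)) hex.choose_spec
      simp only [Units.coe_smul, hα₀def, Units.val_mk0] at h
      exact h.symm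
    rw [hfg]
    exact (isLocallyConstant_smul_units F α₀).comp g
  letI : TopologicalSpace (ZMod p)ˣ := ⊥
  haveI : DiscreteTopology (ZMod p)ˣ := ⟨rfl⟩
  let f : absoluteGaloisGroup F →ₜ* (ZMod p)ˣ := ⟨χ, hlc.continuous⟩
  -- the image of `I_F^u` is a `p`-group in a group of order `p - 1`: trivial
  have hP : IsPGroup p ((absUpperInertia F u).map f.toMonoidHom) := by
    have h := absUpperInertia_map_isPGroup_holds F (ZMod p)ˣ f hu
    rwa [ringChar_residueField_eq_of_irreducible' F hirr] at h
  obtain ⟨k, hk⟩ := hP.exists_card_eq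
  have hdvd : Nat.card ((absUpperInertia F u).map f.toMonoidHom) ∣ p - 1 := by
    have h := Subgroup.card_subgroup_dvd_card ((absUpperInertia F u).map f.toMonoidHom)
    rwa [Nat.card_eq_fintype_card (α := (ZMod p)ˣ), ZMod.card_units_eq_totient p,
      Nat.totient_prime hp1] at h
  have hk0 : k = 0 := by
    by_contra hk0
    rw [hk] at hdvd
    have hpd : p ∣ p - 1 := (dvd_pow_self p hk0).trans hdvd
    exact Nat.not_dvd_of_pos_of_lt (Nat.sub_pos_of_lt hp1.one_lt) (Nat.sub_lt hp1.pos one_pos) hpd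
  rw [hk0, pow_zero] at hk
  have hbot := Subgroup.eq_bot_of_card_eq _ hk
  have hmem : χ σ ∈ (absUpperInertia F u).map f.toMonoidHom := Subgroup.mem_map.mpr ⟨σ, hσ, rfl⟩
  rw [hbot, Subgroup.mem_bot] at hmem
  have h := hχspec σ
  rw [hmem, Units.val_one, ZMod.val_one p, pow_one] at h
  exact h.symm

set_option maxHeartbeats 800000 in
/-- **A peu ramifié Kummer class is the class of a UNIT.**  Let `F` be a characteristic-`0`
non-archimedean local field in which the prime `p` is a uniformiser, and `φ : Γ_F → μ_p` a continuous
`1`-cocycle (tree: `contOneCocycles (mu F p).toTopRep`) which VANISHES on every upper ramification group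
`I_F^u`, `u > 1` (peu ramifié at the cocycle level).  Then `[φ] = κ_p(w) = δ₀(w)` for some UNIT `w` of `F`
(`valuation F w = 1`).  Proof: `[φ] = κ_p(x)` (Kummer, `exists_δ₀_baseUnitsInvariant_eq`); correcting the
`p`-th root by the coboundary witness gives a root `α` of `x` with `φ(σ) = σα/α` EXACTLY, so `I_F^u` fixes
`α`; clearing denominators (`x·d^p ∈ 𝒪_F`) the très-ramifié theorem
(`exists_eq_unit_mul_pow_of_forall_absUpperInertia_smul_eq`) gives `x·d^p = w·z^p`, `w ∈ 𝒪_F^×`, and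
`κ_p(x) = κ_p(w·(z/d)^p) = κ_p(w)`.
[cite: Serre1987, §2.4 (ii) (peu ramifié ⟺ unit Kummer generators)] [cite: SerreLocalFields1979, Ch. X §3 (Kummer theory), Ch. IV §3] -/
theorem exists_oneCocycleClass_eq_δ₀_unit_of_forall_absUpperInertia
    {p : ℕ} [hp : Fact p.Prime] (hirr : Irreducible ((p : ℕ) : 𝒪[F]))
    (φ : contOneCocycles (mu F p).toTopRep)
    (hφ : ∀ u : ℝ, 1 < u → ∀ σ ∈ absUpperInertia F u, φ.1 σ = 0) :
    ∃ (w : F) (hw : w ≠ 0), valuation F w = 1 ∧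
      oneCocycleClass _ φ = (isSES_kummer F p hp.out.pos).δ₀ (baseUnitsInvariant F w hw) := by
  classical
  have hp1 : p.Prime := hp.out
  haveI : NeZero p := ⟨hp1.ne_zero⟩
  set hS := isSES_kummer F p hp1.pos with hSdef
  have hδ : hS.δ₀ = (isSES_kummer F p (NeZero.pos p)).δ₀ := rfl
  -- Kummer: `[φ] = κ_p(x)`
  obtain ⟨x, hx, hxφ⟩ := exists_δ₀_baseUnitsInvariant_eq F (n := p) (oneCocycleClass _ φ)
  rw [← hδ] at hxφ
  set v : (units F).toTopRep.ρ.invariants := baseUnitsInvariant F x hx with hvdef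
  -- a `p`-th root `w₀` of `x` and the coboundary correction
  set w₀ : UnitsCarrier F := hS.lift v.1 with hw₀def
  have hw₀ : (kummerπ F p).hom w₀ = v.1 := hS.g_lift v.1
  have hw₀' : (kummerπ F p).hom w₀ ∈ (units F).toTopRep.ρ.invariants := by rw [hw₀]; exact v.2
  have hclass : hS.δ₀ v = oneCocycleClass _ (hS.δ₀Cocycle w₀ hw₀') := hS.δ₀_apply_eq v w₀ hw₀
  have h0 : oneCocycleClass _ (φ - hS.δ₀Cocycle w₀ hw₀') = 0 := by
    rw [oneCocycleClass_sub, ← hclass, hxφ, sub_self]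
  obtain ⟨m, hm⟩ := (oneCocycleClass_eq_zero_iff _ _).mp h0
  set w : UnitsCarrier F := w₀ + (kummerι F p).hom m with hwdef
  have hw : (kummerπ F p).hom w = v.1 := by
    rw [hwdef, map_add, hw₀, hS.g_f_apply, add_zero]
  -- `φ` is EXACTLY the Kummer cocycle of `w`: `ι(φ σ) = σ w - w`
  have hexact : ∀ σ : absoluteGaloisGroup F,
      (kummerι F p).hom (φ.1 σ) = (units F).toTopRep.ρ σ w - w := by
    intro σ
    have h1 : φ.1 σ = (hS.δ₀Cocycle w₀ hw₀').1 σ + ((mu F p).toTopRep.ρ σ m - m) := by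
      rw [← hm σ]
      change φ.1 σ = (hS.δ₀Cocycle w₀ hw₀').1 σ + (φ.1 σ - (hS.δ₀Cocycle w₀ hw₀').1 σ)
      abel
    rw [h1, map_add, hS.f_δ₀Cocycle_apply, map_sub]
    change (units F) σ w₀ - w₀ + ((kummerι F p).hom ((mu F p) σ m) - (kummerι F p).hom m) =
      (units F) σ w - w
    rw [ContinuousRep.hom_comm_apply (kummerι F p) σ m, hwdef, map_add]
    abel
  -- hence every `I_F^u`, `u > 1`, fixes the unit `α := unitsVal w` of `F̄`
  set α : (AlgebraicClosure F)ˣ := unitsVal F w with hαdef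
  have hfix : ∀ u : ℝ, 1 < u → ∀ σ ∈ absUpperInertia F u, σ • (α : AlgebraicClosure F) = α := by
    intro u hu σ hσ
    have h := hexact σ
    rw [hφ u hu σ hσ, map_zero] at h
    have h' : (units F) σ w = w := (sub_eq_zero.mp h.symm)
    have h'' := congrArg (unitsVal F) h'
    rw [unitsVal_apply, ← hαdef] at h''
    rw [← Units.coe_smul, h'']
  -- `α ^ p = x`
  have hαp : (α : AlgebraicClosure F) ^ p = algebraMap F (AlgebraicClosure F) x := by
    have h := congrArg (unitsVal F) hw
    rw [kummerπ_hom_apply, unitsVal_zsmul, zpow_natCast] at h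
    have h' := congrArg (fun z : (AlgebraicClosure F)ˣ ↦ (z : AlgebraicClosure F)) h
    simpa only [Units.val_pow_eq_pow_val, hvdef, coe_unitsVal_baseUnitsInvariant] using h'
  -- clear denominators: `x = n / d`, `x · d^p = n d^{p-1} ∈ 𝒪_F`
  obtain ⟨n, d, hd, hxnd⟩ := IsFractionRing.div_surjective (A := 𝒪[F]) x
  have hd0 : (d : 𝒪[F]) ≠ 0 := nonZeroDivisors.ne_zero hd
  have hdF : algebraMap 𝒪[F] F d ≠ 0 := fun h ↦ hd0 (IsFractionRing.injective 𝒪[F] F (by rw [h, map_zero]))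
  set xO : 𝒪[F] := n * d ^ (p - 1) with hxOdef
  have hxO : algebraMap 𝒪[F] F xO = x * (algebraMap 𝒪[F] F d) ^ p := by
    rw [hxOdef, map_mul, map_pow, ← hxnd]
    have : p = (p - 1) + 1 := (Nat.sub_add_cancel hp1.one_le).symm
    conv_rhs => rw [this, pow_succ]
    field_simp
  have hx0' : x * (algebraMap 𝒪[F] F d) ^ p ≠ 0 := mul_ne_zero hx (pow_ne_zero _ hdF)
  have hxO0 : xO ≠ 0 := fun h ↦ hx0' (by rw [← hxO, h, map_zero])
  -- the root `y := α · d` of `xO`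
  set y : AlgebraicClosure F := (α : AlgebraicClosure F) * algebraMap F (AlgebraicClosure F)
    (algebraMap 𝒪[F] F d) with hydef
  have hy : y ^ p = algebraMap 𝒪[F] (AlgebraicClosure F) xO := by
    rw [hydef, mul_pow, hαp, ← map_pow, ← map_mul, IsScalarTower.algebraMap_apply 𝒪[F] F
      (AlgebraicClosure F), hxO]
  have hyfix : ∀ u : ℝ, 1 < u → ∀ σ ∈ absUpperInertia F u, σ • y = y := by
    intro u hu σ hσ
    rw [hydef, smul_mul', hfix u hu σ hσ, absoluteGaloisGroup.smul_def, AlgEquiv.commutes]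
  -- the très-ramifié theorem, contrapositive ring form: `xO = w · z^p`
  obtain ⟨wu, z, hwz⟩ :=
    exists_eq_unit_mul_pow_of_forall_absUpperInertia_smul_eq F hirr hxO0 hy hyfix
  have hz0 : (z : 𝒪[F]) ≠ 0 := by
    rintro rfl
    rw [zero_pow hp1.ne_zero, mul_zero] at hwz
    exact hxO0 hwz
  have hzF : algebraMap 𝒪[F] F z ≠ 0 := fun h ↦ hz0 (IsFractionRing.injective 𝒪[F] F (by rw [h, map_zero]))
  have hwF : algebraMap 𝒪[F] F (wu : 𝒪[F]) ≠ 0 :=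
    fun h ↦ wu.ne_zero (IsFractionRing.injective 𝒪[F] F (by rw [h, map_zero]))
  -- `x = w · (z/d)^p` in `F`
  have hxw : x = algebraMap 𝒪[F] F (wu : 𝒪[F]) *
      (algebraMap 𝒪[F] F z / algebraMap 𝒪[F] F d) ^ p := by
    have h := hxO
    rw [hwz, map_mul, map_pow] at h
    rw [div_pow, ← mul_div_assoc, h, mul_div_cancel_right₀ _ (pow_ne_zero _ hdF)]
  refine ⟨algebraMap 𝒪[F] F (wu : 𝒪[F]), hwF, ?_, ?_⟩
  · exact (Valuation.integer.integers (valuation F)).isUnit_iff_valuation_eq_one.mp wu.isUnit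
  · rw [← hxφ]
    have hzd : algebraMap 𝒪[F] F z / algebraMap 𝒪[F] F d ≠ 0 := div_ne_zero hzF hdF
    have h := δ₀_baseUnitsInvariant_mul_pow F (n := p) (algebraMap 𝒪[F] F (wu : 𝒪[F]))
      (algebraMap 𝒪[F] F z / algebraMap 𝒪[F] F d) hwF hzd
    rw [← h]
    congr 1
    exact Subtype.ext (unitsVal_injective F (Units.ext (by
      rw [coe_unitsVal_baseUnitsInvariant, coe_unitsVal_baseUnitsInvariant, hxw])))

/-- **The cup product of a peu ramifié Kummer class with an UNRAMIFIED character vanishes**: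
`[φ] ∪ [θ·id] = 0` in `H²(Γ_F, μ_p)` for `φ` as above (vanishing on every `I_F^u`, `u > 1`) and `θ`
unramified — `[φ] = κ_p(w)` with `w` a unit and `κ_p(u) ∪ θ = 0`
(`cupProduct_kummer_scalarCocycle_eq_zero_of_unit`: units are norms from the unramified extension).
This is the class-field-theoretic input «`c̄_E ∪ ā = 0`» of the anomalous case of Howard's H.5(b)
(`c̄_E` peu ramifié by Serre 1987 §2.8 Prop. 3, `ā` unramified).
[cite: Serre1987, §2.4 (ii), §2.8 Prop. 3] [cite: SerreLocalFields1979, Ch. XIII §4 Prop. 13, Ch. X §3] -/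
theorem cupProduct_oneCocycleClass_scalarCocycle_eq_zero_of_forall_absUpperInertia
    {p : ℕ} [hp : Fact p.Prime] (hirr : Irreducible ((p : ℕ) : 𝒪[F]))
    (φ : contOneCocycles (mu F p).toTopRep)
    (hφ : ∀ u : ℝ, 1 < u → ∀ σ ∈ absUpperInertia F u, φ.1 σ = 0)
    (θ : CyclicCharacter (absoluteGaloisGroup F) p) (hIθ : ∀ σ ∈ absInertia F, θ σ = 0) :
    haveI : CompactSpace (absoluteGaloisGroup F) := absoluteGaloisGroup_compactSpace F
    ((mu F p).tateDualPairing p).cupProduct (oneCocycleClass _ φ)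
        (oneCocycleClass _ (scalarCocycle θ)) = 0 := by
  haveI : NeZero p := ⟨hp.out.ne_zero⟩
  obtain ⟨w, hw, hw1, hφw⟩ := exists_oneCocycleClass_eq_δ₀_unit_of_forall_absUpperInertia F hirr φ hφ
  rw [hφw]
  exact cupProduct_kummer_scalarCocycle_eq_zero_of_unit F θ hIθ w hw hw1

/-! ### §4 Extension classes: `δ₀ v ∪ θ = 0` for an extension of a trivial module by `μ_p` on which the
`I_F^u`, `u > 1`, act trivially (the shape of `c̄_E` at an anomalous place) -/

set_option maxHeartbeats 400000 in
/-- **The connecting class of a peu ramifié extension of discrete `Γ_F`-modules by `μ_p` is the Kummer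
class of a UNIT.**  Let `0 → μ_p →ᶠ M₂ →ᵍ M₃ → 0` be a short exact sequence of discrete `Γ_F`-modules
(tree `IsSES f g`, first term LITERALLY `(mu F p).toTopRep`) such that every `I_F^u`, `u > 1`, acts
TRIVIALLY on `M₂` (for `M₂ = E[p]|Γ_{K_w}`: `ρ̄` peu ramifiée, `isPeuRamifie_restrictField_of_not_dvd_frobeniusTraceAt`),
and `v ∈ M₃^{Γ_F}`.  Then `δ₀ v = κ_p(w)` for a unit `w` of `F`: the connecting cocycle `σ ↦ f⁻¹(σ m̃ - m̃)`
of a lift `m̃` of `v` vanishes on every `I_F^u`, `u > 1`.  (At an anomalous `w ∣ p` with `E(K_w)[p] = 0`: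
`M₂ = E[p]`, `μ_p ≅ Fil_w`, `M₃ = gr_w ≅ ℤ/p` trivial, `v = 1`, `δ₀ v = c̄_E`.)
[cite: Serre1987, §2.4 (ii), §2.8 Prop. 3] [cite: SerreLocalFields1979, Ch. X §3; Ch. IV §3] -/
theorem exists_δ₀_eq_δ₀_unit_of_forall_absUpperInertia_apply_eq
    {p : ℕ} [hp : Fact p.Prime] (hirr : Irreducible ((p : ℕ) : 𝒪[F]))
    {M₂ M₃ : Type u} [AddCommGroup M₂] [TopologicalSpace M₂] [DiscreteTopology M₂]
    [AddCommGroup M₃] [TopologicalSpace M₃] [DiscreteTopology M₃]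
    {ρ₂ : DiscreteGaloisModule F M₂} {ρ₃ : DiscreteGaloisModule F M₃}
    {f : (mu F p).toTopRep ⟶ ρ₂.toTopRep} {g : ρ₂.toTopRep ⟶ ρ₃.toTopRep} (h : IsSES f g)
    (htriv : ∀ u : ℝ, 1 < u → ∀ σ ∈ absUpperInertia F u, ∀ m : M₂, ρ₂ σ m = m)
    (v : ρ₃.toTopRep.ρ.invariants) :
    ∃ (w : F) (hw : w ≠ 0), valuation F w = 1 ∧
      h.δ₀ v = (isSES_kummer F p hp.out.pos).δ₀ (baseUnitsInvariant F w hw) := by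
  set m₀ : M₂ := h.lift v.1 with hm₀def
  have hm₀ : g.hom m₀ ∈ ρ₃.toTopRep.ρ.invariants := by rw [hm₀def, h.g_lift]; exact v.2
  have hδ : h.δ₀ v = oneCocycleClass _ (h.δ₀Cocycle m₀ hm₀) := h.δ₀_apply_eq v m₀ (h.g_lift v.1)
  have hvan : ∀ u : ℝ, 1 < u → ∀ σ ∈ absUpperInertia F u, (h.δ₀Cocycle m₀ hm₀).1 σ = 0 := by
    intro u hu σ hσ
    apply h.injective
    rw [h.f_δ₀Cocycle_apply, map_zero, htriv u hu σ hσ m₀, sub_self]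
  obtain ⟨w, hw, hw1, hcl⟩ :=
    exists_oneCocycleClass_eq_δ₀_unit_of_forall_absUpperInertia F hirr (h.δ₀Cocycle m₀ hm₀) hvan
  exact ⟨w, hw, hw1, hδ.trans hcl⟩

/-- **`δ₀ v ∪ [θ·id] = 0` for an unramified `θ`**, under the hypotheses of
`exists_δ₀_eq_δ₀_unit_of_forall_absUpperInertia_apply_eq` — the statement «`c̄_E ∪ ā = 0` in
`H²(Γ_{K_w}, μ_p)`» of the anomalous case of Howard's H.5(b) (road E / (A1u) of the cell `pub/bsd-print-x9`),
for ANY presentation of `E[p]|Γ_{K_w}` as an extension of a discrete module by `μ_p` and `ā = θ` unramified.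
[cite: Serre1987, §2.4 (ii), §2.8 Prop. 3] [cite: SerreLocalFields1979, Ch. XIII §4 Prop. 13, Ch. X §3] -/
theorem cupProduct_δ₀_scalarCocycle_eq_zero_of_forall_absUpperInertia_apply_eq
    {p : ℕ} [hp : Fact p.Prime] (hirr : Irreducible ((p : ℕ) : 𝒪[F]))
    {M₂ M₃ : Type u} [AddCommGroup M₂] [TopologicalSpace M₂] [DiscreteTopology M₂]
    [AddCommGroup M₃] [TopologicalSpace M₃] [DiscreteTopology M₃]
    {ρ₂ : DiscreteGaloisModule F M₂} {ρ₃ : DiscreteGaloisModule F M₃}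
    {f : (mu F p).toTopRep ⟶ ρ₂.toTopRep} {g : ρ₂.toTopRep ⟶ ρ₃.toTopRep} (h : IsSES f g)
    (htriv : ∀ u : ℝ, 1 < u → ∀ σ ∈ absUpperInertia F u, ∀ m : M₂, ρ₂ σ m = m)
    (v : ρ₃.toTopRep.ρ.invariants)
    (θ : CyclicCharacter (absoluteGaloisGroup F) p) (hIθ : ∀ σ ∈ absInertia F, θ σ = 0) :
    haveI : CompactSpace (absoluteGaloisGroup F) := absoluteGaloisGroup_compactSpace F
    ((mu F p).tateDualPairing p).cupProduct (h.δ₀ v) (oneCocycleClass _ (scalarCocycle θ)) = 0 := by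
  haveI : NeZero p := ⟨hp.out.ne_zero⟩
  obtain ⟨w, hw, hw1, hcl⟩ := exists_δ₀_eq_δ₀_unit_of_forall_absUpperInertia_apply_eq F hirr h htriv v
  rw [hcl]
  exact cupProduct_kummer_scalarCocycle_eq_zero_of_unit F θ hIθ w hw hw1

end Literature.NumberTheory.GaloisCohomology

end
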